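import Literature.RingTheory.FormalGroups.NilpotentEvaluationPairSubst   -- ★ p844752 (β) part 2: `coeff_pow_eq_zero_of_degree_lt`, and (via Pair) `exists_box`, `evalNilp₂_eq_sum_Iic`, `le_iff_fin_two`
import Literature.RingTheory.FormalGroups.NilpotentPointsSeparation      -- ★ p844767 (β) part 3: the one-∕two-variable test algebras (and Mathlib `Ideal.Quotient.Operations`)
import HarnessLib

/-!
# Evaluation of two-variable series at classes in the box quotients `A⟦X₀,…,X_{m-1}⟧ ⧸ (X₀^N, …, X_{m-1}^N)`
# ([Bourbaki, Algebra II] Ch. IV §4 no. 3; [Lazard 1955] §I Lemme 1 — P6d points currency (β), the `m`-variable test algebras)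

Topic `Literature/RingTheory/FormalGroups`; namespace `Literature.RingTheory.FormalGroups`.  THEOREMS ONLY (no definition, no named
fact, no instance, no notation, no `sorry`), sequel of ★ `NilpotentEvaluationPair` ∕ ★ `NilpotentEvaluationPairSubst` ∕ ★
`NilpotentPointsSeparation` (the one- and two-variable test algebras `A⟦X⟧⧸(X^N)`, `A⟦X,Y⟧⧸(X^N,Y^N)`).  Cell `hodgecm-mathlib`, P6 «MOD
programme», sub-desk F0P6d, sub-line 2 `Cruxes/HLiu418/Lines/F0_P6d_ConnectedBTDictionary.lean`, letter (HL-D), LEAD-HAND plan σ1 step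
(P3) ASSOCIATIVITY — «the one place the `Fin 2` engine does not reach»: associativity of a law read on points is a THREE-variable
statement, so one needs the test algebra `T₃ = A⟦X₀,X₁,X₂⟧⧸(X₀^N,X₁^N,X₂^N)` and the bridge between ★ `evalNilp₂` at classes of
`T_m` and Mathlib's `MvPowerSeries.subst`.  This file supplies, for every number of variables `m`:

* §1 the BOX IDEAL `(X₀^N, …, X_{m-1}^N)` of `A⟦X₀,…,X_{m-1}⟧` versus the BOX COEFFICIENTS `d` (`d i < N` for all `i`):
  `coeff_eq_zero_of_mem_span_range_X_pow` (membership kills the box coefficients) and its converse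
  **`mem_span_range_X_pow_of_coeff_eq_zero`** (a series whose box coefficients vanish lies in the ideal — the «first index `i` with
  `d i ≥ N`» decomposition `H = ∑ᵢ Xᵢ^N · Hᵢ`), hence `mk H = mk H' ↔` equal box coefficients (`mk_eq_mk_iff_coeff_eq`);
* §2 classes of constant-free series are NILPOTENT in the box quotient (`isNilpotent_mk_of_constantCoeff_eq_zero`);
* §3 THE BRIDGE **`evalNilp₂_mk_mk`**: `evalNilp₂ G ā b̄ = (G(a,b))‾` in `T_m` for constant-free `a, b ∈ A⟦X₀,…,X_{m-1}⟧` and ANY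
  `G ∈ A⟦X,Y⟧` — ★ `evalNilp₂_eq_sum_Iic` on the left, Mathlib `MvPowerSeries.coeff_subst` cut down to the same box on the right
  (the tail monomials `a^{e₀} b^{e₁}`, `e ≰ n`, lie in the ideal), the difference put into the ideal by §1;
* §4 `natCast_le_order_of_forall_box` (box vanishing ⇒ `↑N ≤ order`, any `m`).

HC_CM is proved only modulo the printed citations until rung 0 closes; nothing here is about HC.

## References
* [BourbakiAlgebraII2003] N. Bourbaki, *Algebra II*, Ch. IV §4 no. 3 (substitution of formal power series; evaluation at nilpotent
  elements).
* [Lazard1955] M. Lazard, *Sur les groupes de Lie formels à un paramètre*, Bull. SMF 83 (1955) — §I, Lemme 1 (congruences modulo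
  degree ∕ the defining ideals of truncations).
-/

noncomputable section

namespace Literature.RingTheory.FormalGroups

open _root_.MvPowerSeries (X coeff constantCoeff monomial subst HasSubst)

universe u v

variable {A : Type u} [CommRing A] {m N : ℕ}

/-! ## §1 The box ideal `(X₀^N, …, X_{m-1}^N)` and the box coefficients -/

/-- `Xᵢ^N` lies in the box ideal `(X₀^N, …, X_{m-1}^N)`. [cite: BourbakiAlgebraII2003, Ch. IV §4 no. 3] -/
theorem X_pow_mem_span_range_X_pow (i : Fin m) :
    (X i : MvPowerSeries (Fin m) A) ^ N ∈ Ideal.span (Set.range fun j : Fin m => (X j : MvPowerSeries (Fin m) A) ^ N) :=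
  Ideal.subset_span ⟨i, rfl⟩

/-- The class `x̄ᵢ` of `Xᵢ` in the box quotient satisfies `x̄ᵢ ^ N = 0`. [cite: BourbakiAlgebraII2003, Ch. IV §4 no. 3] -/
theorem mk_X_pow_eq_zero_of_range (i : Fin m) :
    (Ideal.Quotient.mk (Ideal.span (Set.range fun j : Fin m => (X j : MvPowerSeries (Fin m) A) ^ N)) (X i)) ^ N = 0 := by
  rw [← map_pow, Ideal.Quotient.eq_zero_iff_mem]
  exact X_pow_mem_span_range_X_pow i

/-- **Membership in the box ideal kills the box coefficients**: if `H ∈ (X₀^N, …, X_{m-1}^N)` then `H_d = 0` whenever `d i < N`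
for all `i`. [cite: Lazard1955, §I Lemme 1] -/
theorem coeff_eq_zero_of_mem_span_range_X_pow {H : MvPowerSeries (Fin m) A}
    (hH : H ∈ Ideal.span (Set.range fun j : Fin m => (X j : MvPowerSeries (Fin m) A) ^ N))
    {d : Fin m →₀ ℕ} (hd : ∀ i, d i < N) : coeff d H = 0 := by
  obtain ⟨c, rfl⟩ := Ideal.mem_span_range_iff_exists_fun.mp hH
  rw [map_sum]
  refine Finset.sum_eq_zero fun i _ => ?_
  rw [MvPowerSeries.X_pow_eq, MvPowerSeries.coeff_mul_monomial, if_neg]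
  exact fun h => absurd (Finsupp.single_le_iff.mp h) (not_le.mpr (hd i))

/-- **A series whose box coefficients vanish lies in the box ideal** (converse of `coeff_eq_zero_of_mem_span_range_X_pow`):
`H = ∑ᵢ Xᵢ^N · Hᵢ` where `Hᵢ` collects the exponents whose FIRST coordinate `≥ N` is the `i`-th. [cite: Lazard1955, §I Lemme 1] -/
theorem mem_span_range_X_pow_of_coeff_eq_zero {H : MvPowerSeries (Fin m) A}
    (h : ∀ d : Fin m →₀ ℕ, (∀ i, d i < N) → coeff d H = 0) :
    H ∈ Ideal.span (Set.range fun j : Fin m => (X j : MvPowerSeries (Fin m) A) ^ N) := by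
  classical
  -- `part i` = the coefficients of `H` at the exponents whose first coordinate `≥ N` is `i`, shifted down by `N eᵢ`
  let part : Fin m → MvPowerSeries (Fin m) A := fun i d =>
    if (∀ j, j < i → d j < N) then coeff (d + Finsupp.single i N) H else 0
  have hpart : ∀ (i) (d : Fin m →₀ ℕ),
      coeff d (part i) = if (∀ j, j < i → d j < N) then coeff (d + Finsupp.single i N) H else 0 := fun i d => rfl
  suffices hH : H = ∑ i, (X i : MvPowerSeries (Fin m) A) ^ N * part i by
    rw [hH]
    exact Ideal.sum_mem _ fun i _ => Ideal.mul_mem_right _ _ (X_pow_mem_span_range_X_pow i)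
  ext d
  simp_rw [map_sum, MvPowerSeries.X_pow_eq, MvPowerSeries.coeff_monomial_mul, one_mul]
  by_cases hbox : ∀ i, d i < N
  · rw [h d hbox]
    refine (Finset.sum_eq_zero fun i _ => ?_).symm
    rw [if_neg]
    exact fun hle => absurd (Finsupp.single_le_iff.mp hle) (not_le.mpr (hbox i))
  · -- the first index `i₀` with `N ≤ d i₀`
    simp only [not_forall, not_lt] at hbox
    obtain ⟨i₁, hi₁⟩ := hbox
    let s : Finset (Fin m) := Finset.univ.filter fun i => N ≤ d i
    have hi₁s : i₁ ∈ s := by simp [s, hi₁]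
    have hmem : ∀ {i}, i ∈ s ↔ N ≤ d i := fun {i} => by simp [s]
    have hi₀ : N ≤ d (s.min' ⟨i₁, hi₁s⟩) := hmem.mp (Finset.min'_mem s _)
    have hmin : ∀ j, j < s.min' ⟨i₁, hi₁s⟩ → d j < N := by
      intro j hj
      by_contra hjN
      exact absurd (Finset.min'_le s j (hmem.mpr (not_lt.mp hjN))) (not_le.mpr hj)
    rw [Finset.sum_eq_single (s.min' ⟨i₁, hi₁s⟩)]
    · rw [if_pos (Finsupp.single_le_iff.mpr hi₀), hpart, if_pos, tsub_add_cancel_of_le (Finsupp.single_le_iff.mpr hi₀)]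
      intro j hj
      rw [Finsupp.tsub_apply, Finsupp.single_eq_of_ne (ne_of_lt hj), tsub_zero]
      exact hmin j hj
    · intro i _ hi
      by_cases hle : Finsupp.single i N ≤ d
      · rw [if_pos hle, hpart, if_neg]
        intro hall
        have hlt : s.min' ⟨i₁, hi₁s⟩ < i :=
          lt_of_le_of_ne (Finset.min'_le s i (hmem.mpr (Finsupp.single_le_iff.mp hle))) (Ne.symm hi)
        have h' := hall _ hlt
        rw [Finsupp.tsub_apply, Finsupp.single_eq_of_ne (ne_of_lt hlt), tsub_zero] at h'
        exact absurd hi₀ (not_le.mpr h')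
      · rw [if_neg hle]
    · intro hi; exact absurd (Finset.mem_univ _) hi

/-- **Equality in the box quotient is equality of the box coefficients.** [cite: Lazard1955, §I Lemme 1] -/
theorem mk_eq_mk_iff_coeff_eq {H H' : MvPowerSeries (Fin m) A} :
    Ideal.Quotient.mk (Ideal.span (Set.range fun j : Fin m => (X j : MvPowerSeries (Fin m) A) ^ N)) H =
      Ideal.Quotient.mk (Ideal.span (Set.range fun j : Fin m => (X j : MvPowerSeries (Fin m) A) ^ N)) H' ↔
      ∀ d : Fin m →₀ ℕ, (∀ i, d i < N) → coeff d H = coeff d H' := by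
  rw [Ideal.Quotient.eq]
  refine ⟨fun hmem d hd => ?_, fun hc => mem_span_range_X_pow_of_coeff_eq_zero fun d hd => ?_⟩
  · have hc := coeff_eq_zero_of_mem_span_range_X_pow hmem hd
    rwa [map_sub, sub_eq_zero] at hc
  · rw [map_sub, hc d hd, sub_self]

/-! ## §2 Classes of constant-free series are nilpotent -/

/-- Total degree inside the box: `d i < N` for all `i` ⇒ `|d| < m N + 1`. [cite: BourbakiAlgebraII2003, Ch. IV §4 no. 3] -/
theorem degree_lt_of_forall_lt {d : Fin m →₀ ℕ} (hd : ∀ i, d i < N) : d.degree < m * N + 1 := by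
  rw [Finsupp.degree_eq_sum]
  calc ∑ i, d i ≤ ∑ _i : Fin m, N := Finset.sum_le_sum fun i _ => (hd i).le
    _ = m * N := by rw [Finset.sum_const, Finset.card_univ, Fintype.card_fin, smul_eq_mul]
    _ < m * N + 1 := Nat.lt_succ_self _

/-- **A constant-free series is nilpotent in the box quotient**: `ā ^ (m N + 1) = 0` (the coefficients of `a ^ (mN+1)` below total
degree `mN + 1` vanish, and the box lies below that degree). [cite: BourbakiAlgebraII2003, Ch. IV §4 no. 3] -/
theorem isNilpotent_mk_of_constantCoeff_eq_zero {a : MvPowerSeries (Fin m) A} (ha : constantCoeff a = 0) :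
    IsNilpotent (Ideal.Quotient.mk (Ideal.span (Set.range fun j : Fin m => (X j : MvPowerSeries (Fin m) A) ^ N)) a) := by
  refine ⟨m * N + 1, ?_⟩
  rw [← map_pow, Ideal.Quotient.eq_zero_iff_mem]
  exact mem_span_range_X_pow_of_coeff_eq_zero fun d hd => coeff_pow_eq_zero_of_degree_lt ha (degree_lt_of_forall_lt hd)

/-! ## §3 The bridge: `evalNilp₂` at classes of the box quotient is the class of the substitution -/

/-- The monomial `a^{e₀} b^{e₁}` of the substitution formula, for a pair of series in any variables. [cite: BourbakiAlgebraII2003, Ch. IV §4 no. 3] -/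
theorem prod_pair_pow_mv {τ : Type*} (a b : MvPowerSeries τ A) (e : Fin 2 →₀ ℕ) :
    (e.prod fun i k => ((![a, b] : Fin 2 → MvPowerSeries τ A) i) ^ k) = a ^ (e 0) * b ^ (e 1) := by
  rw [Finsupp.prod_fintype _ _ (fun _ => pow_zero _)]
  simp [Fin.prod_univ_two]

/-- Tail monomials lie in the box ideal: if `a^{n₀+1}, b^{n₁+1} ∈ I` then `a^{e₀} b^{e₁} ∈ I` for every `e ≰ n`. [cite: Lazard1955, §I Lemme 1] -/
theorem pow_mul_pow_mem_of_not_le {I : Ideal (MvPowerSeries (Fin m) A)} {a b : MvPowerSeries (Fin m) A} {n e : Fin 2 →₀ ℕ}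
    (ha : a ^ (n 0 + 1) ∈ I) (hb : b ^ (n 1 + 1) ∈ I) (he : ¬ e ≤ n) : a ^ (e 0) * b ^ (e 1) ∈ I := by
  rw [le_iff_fin_two, not_and_or, not_le, not_le] at he
  rcases he with h0 | h1
  · rw [show e 0 = (n 0 + 1) + (e 0 - (n 0 + 1)) by omega, pow_add, mul_assoc]
    exact I.mul_mem_right _ ha
  · rw [show e 1 = (n 1 + 1) + (e 1 - (n 1 + 1)) by omega, pow_add, mul_left_comm]
    exact I.mul_mem_right _ hb

/-- **THE BRIDGE.**  In the box quotient `T_m = A⟦X₀,…,X_{m-1}⟧⧸(X₀^N,…,X_{m-1}^N)`, for constant-free `a, b` and any two-variable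
series `G`: `evalNilp₂ G ā b̄ = (G(a,b))‾`, where `G(a,b)` is Mathlib's `MvPowerSeries.subst ![a, b] G`.  (Left: the box sum ★
`evalNilp₂_eq_sum_Iic`; right: `coeff_subst` cut down to the same box, the tails lying in the ideal; the two agree coefficientwise on
the box, hence in `T_m` by §1.) [cite: BourbakiAlgebraII2003, Ch. IV §4 no. 3] [cite: Lazard1955, §I Lemme 1] -/
theorem evalNilp₂_mk_mk (G : MvPowerSeries (Fin 2) A) {a b : MvPowerSeries (Fin m) A} (ha : constantCoeff a = 0)
    (hb : constantCoeff b = 0) :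
    evalNilp₂ G (Ideal.Quotient.mk (Ideal.span (Set.range fun j : Fin m => (X j : MvPowerSeries (Fin m) A) ^ N)) a)
      (Ideal.Quotient.mk (Ideal.span (Set.range fun j : Fin m => (X j : MvPowerSeries (Fin m) A) ^ N)) b) =
      Ideal.Quotient.mk (Ideal.span (Set.range fun j : Fin m => (X j : MvPowerSeries (Fin m) A) ^ N)) (subst ![a, b] G) := by
  classical
  obtain ⟨n, hun, hvn⟩ := exists_box (isNilpotent_mk_of_constantCoeff_eq_zero (N := N) ha)
    (isNilpotent_mk_of_constantCoeff_eq_zero (N := N) hb)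
  have hab : HasSubst ![a, b] := MvPowerSeries.hasSubst_of_constantCoeff_zero fun i => by fin_cases i <;> simp [ha, hb]
  set I : Ideal (MvPowerSeries (Fin m) A) := Ideal.span (Set.range fun j : Fin m => (X j : MvPowerSeries (Fin m) A) ^ N) with hI
  have han : a ^ (n 0 + 1) ∈ I := by rw [← Ideal.Quotient.eq_zero_iff_mem, map_pow]; exact hun
  have hbn : b ^ (n 1 + 1) ∈ I := by rw [← Ideal.Quotient.eq_zero_iff_mem, map_pow]; exact hvn
  -- the left-hand side, pushed through `mk`
  rw [evalNilp₂_eq_sum_Iic G hun hvn]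
  have hlhs : ∑ e ∈ Finset.Iic n, algebraMap A (MvPowerSeries (Fin m) A ⧸ I) (coeff e G) *
        ((Ideal.Quotient.mk I a) ^ (e 0) * (Ideal.Quotient.mk I b) ^ (e 1)) =
      Ideal.Quotient.mk I (∑ e ∈ Finset.Iic n, coeff e G • (a ^ (e 0) * b ^ (e 1))) := by
    rw [map_sum]
    refine Finset.sum_congr rfl fun e _ => ?_
    rw [Algebra.smul_def, map_mul, map_mul, map_pow, map_pow, Ideal.Quotient.mk_algebraMap]
  rw [hlhs, mk_eq_mk_iff_coeff_eq]
  intro d hd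
  -- the right-hand side: `coeff_subst`, a finite sum over the box `Iic n` (tails have vanishing box coefficients)
  rw [MvPowerSeries.coeff_subst hab G d, finsum_eq_sum_of_support_subset _ (s := Finset.Iic n)]
  · rw [map_sum]
    refine Finset.sum_congr rfl fun e _ => ?_
    rw [map_smul, prod_pair_pow_mv]
  · intro e he
    simp only [Function.mem_support, ne_eq, Finset.coe_Iic, Set.mem_Iic] at he ⊢
    by_contra hen
    apply he
    rw [prod_pair_pow_mv, coeff_eq_zero_of_mem_span_range_X_pow (pow_mul_pow_mem_of_not_le han hbn hen) hd, smul_zero]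

/-- The bridge at the variables: `evalNilp₂ G x̄ᵢ x̄ⱼ = (G(Xᵢ, Xⱼ))‾`. [cite: BourbakiAlgebraII2003, Ch. IV §4 no. 3] -/
theorem evalNilp₂_mk_X_mk_X (G : MvPowerSeries (Fin 2) A) (i j : Fin m) :
    evalNilp₂ G (Ideal.Quotient.mk (Ideal.span (Set.range fun j : Fin m => (X j : MvPowerSeries (Fin m) A) ^ N)) (X i))
      (Ideal.Quotient.mk (Ideal.span (Set.range fun j : Fin m => (X j : MvPowerSeries (Fin m) A) ^ N)) (X j)) =
      Ideal.Quotient.mk (Ideal.span (Set.range fun j : Fin m => (X j : MvPowerSeries (Fin m) A) ^ N))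
        (subst ![(X i : MvPowerSeries (Fin m) A), X j] G) :=
  evalNilp₂_mk_mk G (MvPowerSeries.constantCoeff_X i) (MvPowerSeries.constantCoeff_X j)

/-! ## §4 From box vanishing to `↑N ≤ order` -/

/-- Coefficients vanishing on the box `d i < N` force `↑N ≤ order` (total degree `< N` implies each exponent `< N`).
[cite: Lazard1955, §I Lemme 1] -/
theorem natCast_le_order_of_forall_box {σ : Type*} {H : MvPowerSeries σ A}
    (h : ∀ d : σ →₀ ℕ, (∀ i, d i < N) → coeff d H = 0) : (N : ℕ∞) ≤ H.order :=
  MvPowerSeries.nat_le_order fun d hd =>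
    h d fun i => lt_of_le_of_lt (Finsupp.le_degree i d) (by exact_mod_cast hd)

end Literature.RingTheory.FormalGroups
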